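import Summits.QuantumFields.YangMills.Theorems.BalabanUVNodesK3V5Defs
import Summits.QuantumFields.YangMills.Theorems.BalabanUVNodesN15FullPropagatorSizedLive
import Summits.QuantumFields.YangMills.Theorems.BalabanUVNodesN16PinnedLooseMatch

/-!
# K3⁷ v5 — STUB 1's TEXT BY NAME ⟺ ITS LETTER NORMAL FORM; the ALL-PINS reading MINTED; v5's one guard is implied by its own N15 pin

Cell `pub-ymgap` (HUMAN RULING D-0062 Track A; director-ym №197 ∕ HUMAN RULING D-0149), WIDTH SEAT `pub-ymgap-dag-n27-w1` (gen 3) on NODE n27 (B5 composite).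
`--kind proof --supports stmt-QuantumFields-20544 --as helper` (count-neutral).  THEOREMS ONLY, 0 `def`, 0 `sorry`, standard axioms; `N = 2` (= the stub texts).
Sequel of this seat's gen-2 by-name mirror `Thm/BalabanUVNodesK3V5Defs.lean` (p606160), whose §3 bill `keyedRatesHolderD4_rrOfRecord_of_pins_of_letters` ends
«NOT a proof of the stub (no `∃ 𝔯`, no `KeyedLive`, no window)».  THIS FILE closes exactly those three residues of K3⁷ v5's `stub_rates13H`
(`∃ β, 2/3 < β ∧ β < 1 ∧ ∃ 𝔯 ksel ℓ ℓ₃ g B, GuardedReadingN16 𝔯 ksel ℓ ℓ₃ g B ∧ KeyedRatesHolderD4 β (rrOfRecord 𝔯 ksel)`, skeleton 941dddb108cbaacf) BY NAME and nothing else: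

* §1 `exists_reading_v5pins` — for EVERY choice of letters (`0 < l₀`, `0 ≤ Λ`, `0 < b`, `0 < a_S`, directions, `c₃₅`, `p`, a letter-block reading `ℓ`, N16's letters `ℓ₃`,
  radius letter `B`) SOME Stage-13 rate reading carries ALL FOUR v5 pins `Ne1PinnedOfRecord ∧ N15PinnedSized ∧ U3PinnedKernels · ℓ ∧ N16PinnedLoose · ℓ₃ B` — the reading
  `⟨fun F θ hP g₀ os ↦ ⟨objectsOfRecord₁₃ F 2 θ (ℓ F θ), fun _ ↦ the loose N16 layer of record, fun _ ↦ fullGSizedObjects 3 F.hL …⟩, ne1OfRecord l₀ Λ⟩`, four `rfl`s.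
  A HYPOTHESIS-FREE (A6) joint inhabitant of the four pins (each pin alone was inhabited in its definer's file; jointly nowhere).
* §2 `keyedLive_rrOfRecord_of_n15PinnedSized` — v5's one remaining GUARD `KeyedLive (rrOfRecord 𝔯 ksel)` FOLLOWS from v5's own (α-N15) PIN, for EVERY selector (dag-n15-a
  `live_fullGSizedObjects_family`: the sized genuine family is live); hence `guardedReading_iff_pins` (`GuardedReading 𝔯 ksel ℓ ↔` the three pins) and
  `exists_guardedReadingN16_iff_letterRows` (`(∃ 𝔯 ksel, GuardedReadingN16 𝔯 ksel ℓ ℓ₃ g B) ↔ N16LettersEnd 2 g ℓ₃ ∧ N16RadiusMatch ℓ₃ B`): the keys of stub 1 are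
  inhabited by the canonical pinned reading EXACTLY when node N16's two letter rows hold.
* §3 `rrOfRecord_eq_of_pins` — under the four pins the bundle of record at the selected run length IS the SPELLED bundle of letters; ★★★ `stub1Text_iff_letterForm` — STUB 1's
  TEXT ⟺ «some `β ∈ ]2/3,1[`, some letters with the two N16 rows, some run-length selector, and `KeyedRatesHolderD4 β` AT THE SPELLED BUNDLE OF LETTERS»: the reading `𝔯`
  carries NO content beyond its letters, the selector none beyond the run length it reads (the honest normal form of what the stub asserts).
* §4 ★★★ `stub1Text_of_rows` — STUB 1's TEXT VERBATIM from gen-2's bill rows: ONE `N16HolderAt … β` per guarded family at the loose-data object (`h16`), def-W1's four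
  finite-volume kernel letters of record, the U3 letter rows `Signs ∕ 0 < κ ∕ betaPrime510 4 1 κ ≤ cr ∕ 0 ≤ ρ < 1`, the two N16 letter rows, at any `β ∈ ]2/3,1[`;
  ★★ `stub1Text_of_n16Producer_of_rows` — the N16 rows AND `h16` replaced by the OUTPUT SHAPE of node N16's producers (dag-n16-e `…N16PinnedLooseMatch`
  `exists_letters_n16HolderAtReading_loose_of_h5_thm1At_match` ∕ `…OfLettersB9Src…_match`: `∃ ℓ₃ B, N16LettersEnd 2 g ℓ₃ ∧ (match row) ∧ … ∧ ∀ 𝔯, N16PinnedLoose 𝔯 ℓ₃ B →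
  N16HolderAtReading 𝔯 β`), so that STUB 1 ⟸ node N05's `h5` + leaf-06's [B11] Theorem-1 reading + the U3 rows + the four kernel letters, by ONE `obtain`.
* §5 `spineGivenEndpointR13SepCoPH_of_rows_of_stub2Text` — K3⁷ BY NAME from §4's rows and stub 2's text (gen-2's `spineGivenEndpointR13SepCoPH_of_stubTexts`).

HONEST FRAMING.  COMPOSITE-node bookkeeping BY NAME: two hypothesis-free inhabitation facts about v5's KEYS (pins ∕ guard) and REDUCTIONS; NOT a proof of
`stub_rates13H` — its estimate rows (THE END's N16 sentence ∕ the [B11] Thm 1 reading behind node N16's producers; def-W1's four finite-volume kernel letters, statements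
of Bałaban-type SHAPE NOT PRINTED as such for d = 4, (1.21)'s existence [I] p.264 NOT proved, (5.10) for the limiting kernels = print's claim [I] p.293) stay DISPLAYED
HYPOTHESES inhabited for no family today (K0⁷ `Record13SepCoPHInhabited` OPEN); the minted reading's N14 ∕ N15 components are dag-n14-w1's datum-read tower ∕ dag-n15-a's
MODEL-level sized family (v5's own labels (t-N14) ∕ (A3-iii)) — «model vs object» is the label question of record, not decided here; nothing of Bałaban's asserted or
instantiated; N14–N22 ∕ N27 NOT discharged; K3⁷ stmt-QuantumFields-20544 OPEN, NOT claimed; skeleton v5 UNTOUCHED (plan's); counts UNMOVED (typed 28∕28 · discharged 5∕27,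
A 5∕28).  One finite 𝕋⁴ programme at fixed `ε`, Bałaban AS PRINTED — R4 closes the CONDITIONAL finite-𝕋⁴ rung `BalabanLadder.UV` only: NOT continuum ∕ ℝ⁴ ∕ OS ∕ mass gap ∕
Clay; the Yang–Mills mass gap is NOT proved by any of this.  [I] = [Balaban1987RG1].
-/

set_option autoImplicit false

noncomputable section

open scoped Matrix.Norms.L2Operator

namespace Summit.QuantumFields.YangMills.Theorems.K3V5Defs

open Literature.MathematicalPhysics.QuantumFieldTheory.Balaban1983to89
open Literature.MathematicalPhysics.QuantumFieldTheory.Balaban1983to89.T4Continuum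
open Literature.MathematicalPhysics.QuantumFieldTheory.Balaban1983to89.B12Sec2to5 (betaPrime510)
open Literature.MathematicalPhysics.QuantumFieldTheory.Balaban1983to89.Node00.U3OfKernels (objectsOfRecord₁₃ KernelDecayOfRecord₁₃)
open Literature.MathematicalPhysics.QuantumFieldTheory.Balaban1983to89.Node00.U3KernelLetters (PolLimitsExistOfRecord₁₃ WindowedNE9OfRecord₁₃ WindowedDecayOfRecord₁₃
  WindowedStepRateOfRecord₁₃)
open T4ContinuumYM4Torus (ForSmallCouplings)
open Summit.QuantumFields.BalabanUV.T4Continuum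
open Summit.QuantumFields.BalabanUV.T4Continuum.Spine
open MinimalActionRate (sfClass)
open YMDAG.UVSplit
open YMDAG.N14.TopBorn (Ne1PinnedOfRecord ne1OfRecord)
open Node00 (Stage13HParams datumOfRecord₁₃CoPH U3Letters₁₁ NE3Letters₁₁ NE3Objects₁₁ RateObjects₁₁ ne3ConstLayerOfRecord₁₁ ne3NperOfRecord₁₁ ne3DomOfRecord₁₁)
open Summit.QuantumFields.YangMills.BalabanUVNodes.N16HolderDefs (N16HolderAt)
open Summit.QuantumFields.YangMills.BalabanUVNodes.N16PinnedLayer13CoPH (N16PinnedLoose N16LettersEnd N16HolderAtReading rateCarriers_ne3_of_pinnedLoose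
  n16HolderAtReading_iff_of_pinnedLoose)
open Summit.QuantumFields.YangMills.BalabanUVNodes.N15.PairedFamilyGuard (Live KeyedLive)
open Summit.QuantumFields.YangMills.BalabanUVNodes.N15.GenuineRecord (fullGSizedObjects live_fullGSizedObjects_family)
open Summit.QuantumFields.YangMills.BalabanUVNodes.N15.AtKeyedHome (neZero_blockFactor)

/-! ## §1 The reading carrying all four v5 pins, minted (hypothesis-free) -/

/-- ★ **THE ALL-PINS READING EXISTS, FOR EVERY CHOICE OF LETTERS** (`0 < l₀`, `0 ≤ Λ`, `0 < b`, `0 < a_S`): SOME Stage-13 rate reading carries v5's four pins JOINTLY —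
N14's `Ne1PinnedOfRecord` (dag-n14-w1), the (α-N15) model-level pin `N15PinnedSized` (dag-n15-a's sized genuine objects), the node-U3 pin `U3PinnedKernels · ℓ` (def-W1's kernel
objects of record at the letter block `ℓ F θ`) and node N16's loose pin `N16PinnedLoose · ℓ₃ B` (module 43).  Witness: the reading whose `lit F θ hP g₀ os` is
`⟨objectsOfRecord₁₃ F 2 θ (ℓ F θ), fun _ ↦ loose layer of record at radius (ℓ₃ F).ε ∕ B F, fun _ ↦ fullGSizedObjects 3 F.hL b a_S ν μ α β′ c₃₅ p⟩` and whose `ne1` is `ne1OfRecord l₀ Λ`;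
every pin by `rfl`.  A joint A6 inhabitant of the KEYS of `stub_rates13H`; no estimate. [bookkeeping] -/
theorem exists_reading_v5pins (l₀ Λ b aS : ℝ) (ν μ α β' : Fin 4) (c35 p : ℝ) (ℓ : LetterReading) (ℓ₃ : T4Family → NE3Letters₁₁) (B : T4Family → ℝ)
    (hl₀ : 0 < l₀) (hΛ : 0 ≤ Λ) (hb : 0 < b) (haS : 0 < aS) :
    ∃ 𝔯 : RateReading₁₃CoPH 2, Ne1PinnedOfRecord 𝔯 ∧ N15PinnedSized 𝔯 ∧ U3PinnedKernels 𝔯 ℓ ∧ N16PinnedLoose 𝔯 ℓ₃ B := by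
  let lit : (F : T4Family) → (θ : Stage13HParams F 2) → θ.Provisos₁₃CoPH F 2 → (ℕ → ℝ) → List (ULoop F) → RateObjects₁₁ 2 :=
    fun F θ _ _ _ =>
      ⟨objectsOfRecord₁₃ F 2 θ.toStage13Params (ℓ F θ),
        fun _ => { ne3ConstLayerOfRecord₁₁ F 2 (ℓ₃ F) with
          dom := {V | V ∈ ne3DomOfRecord₁₁ F 2 0 0 ∧ V ∈ sfClass 4 F.L (ne3NperOfRecord₁₁ F 0 0) ((ℓ₃ F).ε / B F) 0} },
        fun _ => haveI := neZero_blockFactor F; fullGSizedObjects 3 F.hL b aS ν μ α β' c35 p⟩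
  refine ⟨⟨lit, ne1OfRecord l₀ Λ⟩, ⟨l₀, Λ, hl₀, hΛ, fun _ _ _ _ _ => rfl⟩, ⟨b, aS, ν, μ, α, β', c35, p, hb, haS, fun _ _ _ _ _ _ => rfl⟩,
    fun _ _ _ _ _ => rfl, fun _ _ _ _ _ _ => rfl⟩

/-! ## §2 v5's one guard follows from its own N15 pin; the keys of stub 1 are inhabited iff node N16's two letter rows hold -/

section Guard

variable {𝔯 : RateReading₁₃CoPH 2}

/-- ★ **THE GUARD FROM THE PIN**: a reading carrying the (α-N15) pin `N15PinnedSized` passes N15's keyed liveness guard `KeyedLive (rrOfRecord 𝔯 ksel)` for EVERY run-length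
selector — at every tuple the selected NE2 carriers ARE the sized genuine family's, which is `Live` (dag-n15-a `live_fullGSizedObjects_family`, dag-n15-w2's guard BY NAME).
So v5's `GuardedReading` has NO guard content beyond its pins. [bookkeeping] -/
theorem keyedLive_rrOfRecord_of_n15PinnedSized (h : N15PinnedSized 𝔯) (ksel : RunSel) : KeyedLive (rrOfRecord 𝔯 ksel) := by
  obtain ⟨b, aS, ν, μ, α, β', c35, p, -, -, h2⟩ := h
  intro F θ hP _ _ g₀ os
  show Live (ne2OfRecord₁₁ ((𝔯.lit F θ hP g₀ os).ne2 (ksel F θ hP g₀ os)))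
  rw [h2 F θ hP g₀ os]
  exact live_fullGSizedObjects_family F b aS ν μ α β' c35 p

/-- **v5's `GuardedReading` IS ITS THREE PINS** (the `KeyedLive` conjunct is implied by `N15PinnedSized`). [bookkeeping] -/
theorem guardedReading_iff_pins (ksel : RunSel) (ℓ : LetterReading) :
    GuardedReading 𝔯 ksel ℓ ↔ Ne1PinnedOfRecord 𝔯 ∧ N15PinnedSized 𝔯 ∧ U3PinnedKernels 𝔯 ℓ :=
  ⟨fun h => ⟨h.1, h.2.2.1, h.2.2.2⟩, fun h => ⟨h.1, keyedLive_rrOfRecord_of_n15PinnedSized h.2.1 ksel, h.2.1, h.2.2⟩⟩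

/-- **v5's `GuardedReadingN16` IS ITS FOUR PINS AND NODE N16's TWO LETTER ROWS.** [bookkeeping] -/
theorem guardedReadingN16_iff_pins_letterRows (ksel : RunSel) (ℓ : LetterReading) (ℓ₃ : T4Family → NE3Letters₁₁) (g B : T4Family → ℝ) :
    GuardedReadingN16 𝔯 ksel ℓ ℓ₃ g B ↔
      (Ne1PinnedOfRecord 𝔯 ∧ N15PinnedSized 𝔯 ∧ U3PinnedKernels 𝔯 ℓ ∧ N16PinnedLoose 𝔯 ℓ₃ B) ∧ (N16LettersEnd 2 g ℓ₃ ∧ N16RadiusMatch ℓ₃ B) := by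
  constructor
  · rintro ⟨hG, hL, hE, hM⟩
    exact ⟨⟨hG.1, hG.2.2.1, hG.2.2.2, hL⟩, hE, hM⟩
  · rintro ⟨⟨h1, h2, h3, hL⟩, hE, hM⟩
    exact ⟨(guardedReading_iff_pins ksel ℓ).2 ⟨h1, h2, h3⟩, hL, hE, hM⟩

/-- The selector is NOT read by the keys: a reading guarded at one selector is guarded at every selector. [bookkeeping] -/
theorem guardedReadingN16_of_guardedReadingN16 {ksel : RunSel} {ℓ : LetterReading} {ℓ₃ : T4Family → NE3Letters₁₁} {g B : T4Family → ℝ}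
    (h : GuardedReadingN16 𝔯 ksel ℓ ℓ₃ g B) (ksel' : RunSel) : GuardedReadingN16 𝔯 ksel' ℓ ℓ₃ g B :=
  (guardedReadingN16_iff_pins_letterRows ksel' ℓ ℓ₃ g B).2 ((guardedReadingN16_iff_pins_letterRows ksel ℓ ℓ₃ g B).1 h)

end Guard

/-- ★ **THE KEYS OF STUB 1 ARE INHABITED IFF NODE N16's TWO LETTER ROWS HOLD**: for every letter-block reading `ℓ`, letters `ℓ₃`, coupling letter `g`, radius letter `B`,
`(∃ 𝔯 ksel, GuardedReadingN16 𝔯 ksel ℓ ℓ₃ g B) ↔ N16LettersEnd 2 g ℓ₃ ∧ N16RadiusMatch ℓ₃ B` — «⇐» by the minted all-pins reading (§1, letters `l₀ = b = a_S = 1`, `Λ = 0`,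
directions `0`) and the guard-from-pin (§2), any selector.  What v5's guard architecture costs a prover of `stub_rates13H`: exactly node N16's two letter rows (dag-n16-e's
producers deliver them); the rest of the stub is `KeyedRatesHolderD4`. [bookkeeping] -/
theorem exists_guardedReadingN16_iff_letterRows (ℓ : LetterReading) (ℓ₃ : T4Family → NE3Letters₁₁) (g B : T4Family → ℝ) :
    (∃ (𝔯 : RateReading₁₃CoPH 2) (ksel : RunSel), GuardedReadingN16 𝔯 ksel ℓ ℓ₃ g B) ↔ N16LettersEnd 2 g ℓ₃ ∧ N16RadiusMatch ℓ₃ B := by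
  constructor
  · rintro ⟨𝔯, ksel, h⟩
    exact ((guardedReadingN16_iff_pins_letterRows ksel ℓ ℓ₃ g B).1 h).2
  · rintro ⟨hE, hM⟩
    obtain ⟨𝔯, h1, h2, h3, hL⟩ := exists_reading_v5pins 1 0 1 1 0 0 0 0 0 0 ℓ ℓ₃ B one_pos le_rfl one_pos one_pos
    exact ⟨𝔯, fun _ _ _ _ _ => 0, (guardedReadingN16_iff_pins_letterRows _ ℓ ℓ₃ g B).2 ⟨⟨h1, h2, h3, hL⟩, hE, hM⟩⟩

/-- … and then SOME reading is guarded at EVERY selector. [bookkeeping] -/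
theorem exists_reading_forall_guardedReadingN16_of_letterRows (ℓ : LetterReading) {ℓ₃ : T4Family → NE3Letters₁₁} {g B : T4Family → ℝ}
    (hE : N16LettersEnd 2 g ℓ₃) (hM : N16RadiusMatch ℓ₃ B) :
    ∃ 𝔯 : RateReading₁₃CoPH 2, ∀ ksel : RunSel, GuardedReadingN16 𝔯 ksel ℓ ℓ₃ g B := by
  obtain ⟨𝔯, ksel, h⟩ := (exists_guardedReadingN16_iff_letterRows ℓ ℓ₃ g B).2 ⟨hE, hM⟩
  exact ⟨𝔯, fun ksel' => guardedReadingN16_of_guardedReadingN16 h ksel'⟩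

/-! ## §3 Under the pins the bundle of record IS the spelled bundle of letters; STUB 1's TEXT ⟺ its letter normal form -/

section LetterForm

/-- **UNDER THE FOUR PINS THE BUNDLE OF RECORD AT THE SELECTED RUN LENGTH IS THE SPELLED BUNDLE OF LETTERS** — N14's object of record `ne1OfRecord l₀ Λ` read off the datum,
the sized genuine N15 family, the loose N16 layer of record, node U3's carriers of def-W1's kernel objects at run length `ksel F θ hP g₀ os`; nothing of `𝔯` survives. [bookkeeping] -/
theorem rrOfRecord_eq_of_pins {𝔯 : RateReading₁₃CoPH 2} {ℓ : LetterReading} {ℓ₃ : T4Family → NE3Letters₁₁} {B : T4Family → ℝ}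
    {l₀ Λ b aS : ℝ} {ν μ α β' : Fin 4} {c35 p : ℝ}
    (h1 : ∀ (F : T4Family) (θ : Stage13HParams F 2) (hP : θ.Provisos₁₃CoPH F 2) (g₀ : ℕ → ℝ) (os : List (ULoop F)), 𝔯.ne1 F θ hP g₀ os = ne1OfRecord l₀ Λ F θ hP g₀ os)
    (h2 : ∀ (F : T4Family) (θ : Stage13HParams F 2) (hP : θ.Provisos₁₃CoPH F 2) (g₀ : ℕ → ℝ) (os : List (ULoop F)) (k : ℕ),
      (𝔯.lit F θ hP g₀ os).ne2 k = haveI := neZero_blockFactor F; fullGSizedObjects 3 F.hL b aS ν μ α β' c35 p)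
    (h3 : U3PinnedKernels 𝔯 ℓ) (hL : N16PinnedLoose 𝔯 ℓ₃ B) (ksel : RunSel)
    (F : T4Family) (θ : Stage13HParams F 2) (hP : θ.Provisos₁₃CoPH F 2) (g₀ : ℕ → ℝ) (os : List (ULoop F)) :
    rrOfRecord 𝔯 ksel F θ hP g₀ os =
      ⟨ne1OfRecord l₀ Λ F θ hP g₀ os, ne2OfRecord₁₁ (haveI := neZero_blockFactor F; fullGSizedObjects 3 F.hL b aS ν μ α β' c35 p),
        ne3OfRecord₁₁ F { ne3ConstLayerOfRecord₁₁ F 2 (ℓ₃ F) with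
          dom := {V | V ∈ ne3DomOfRecord₁₁ F 2 0 0 ∧ V ∈ sfClass 4 F.L (ne3NperOfRecord₁₁ F 0 0) ((ℓ₃ F).ε / B F) 0} },
        u3OfRecord₁₃ θ.toStage13Params (objectsOfRecord₁₃ F 2 θ.toStage13Params (ℓ F θ)) (ksel F θ hP g₀ os)⟩ := by
  show (⟨𝔯.ne1 F θ hP g₀ os, ne2OfRecord₁₁ ((𝔯.lit F θ hP g₀ os).ne2 (ksel F θ hP g₀ os)), ne3OfRecord₁₁ F ((𝔯.lit F θ hP g₀ os).ne3 (ksel F θ hP g₀ os)),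
    u3OfRecord₁₃ θ.toStage13Params (𝔯.lit F θ hP g₀ os).u3 (ksel F θ hP g₀ os)⟩ : RateCarriers 2) = _
  rw [h1 F θ hP g₀ os, h2 F θ hP g₀ os, hL F θ hP g₀ os, h3 F θ hP g₀ os]

/-- ★★★ **STUB 1's TEXT ⟺ ITS LETTER NORMAL FORM.**  K3⁷ v5's `stub_rates13H` text (left, VERBATIM over the mirrored names) holds iff for SOME `β ∈ ]2/3, 1[`, SOME letters
(`0 < l₀`, `0 ≤ Λ`, `0 < b`, `0 < a_S`, directions, `c₃₅`, `p`, letter-block reading `ℓ`, N16 letters `ℓ₃`, coupling letter `g`, radius letter `B`) carrying node N16's two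
letter rows `N16LettersEnd 2 g ℓ₃ ∧ N16RadiusMatch ℓ₃ B`, and SOME run-length selector `ksel`, the FSC-keyed rates predicate `KeyedRatesHolderD4 β` holds AT THE SPELLED BUNDLE OF
LETTERS `fun F θ hP g₀ os ↦ ⟨ne1OfRecord l₀ Λ F θ hP g₀ os, ne2OfRecord₁₁ (fullGSizedObjects 3 F.hL b a_S …), ne3OfRecord₁₁ F (loose layer ℓ₃ B), u3OfRecord₁₃ θ (objectsOfRecord₁₃ F 2 θ (ℓ F θ))
(ksel F θ hP g₀ os)⟩`.  «⇒»: the pins determine the bundle (`rrOfRecord_eq_of_pins`); «⇐»: the minted reading (§1), guard from pin (§2), `rfl`.  What the stub asserts, with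
no reading and no guard in the statement. [bookkeeping] -/
theorem stub1Text_iff_letterForm :
    (∃ β : ℝ, 2 / 3 < β ∧ β < 1 ∧
      ∃ (𝔯 : RateReading₁₃CoPH 2) (ksel : RunSel) (ℓ : LetterReading) (ℓ₃ : T4Family → Node00.NE3Letters₁₁) (g B : T4Family → ℝ),
        GuardedReadingN16 𝔯 ksel ℓ ℓ₃ g B ∧ KeyedRatesHolderD4 β (rrOfRecord 𝔯 ksel)) ↔
    ∃ β : ℝ, 2 / 3 < β ∧ β < 1 ∧
      ∃ (l₀ Λ b aS : ℝ) (ν μ α β' : Fin 4) (c35 p : ℝ) (ℓ : LetterReading) (ℓ₃ : T4Family → NE3Letters₁₁) (g B : T4Family → ℝ) (ksel : RunSel),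
        0 < l₀ ∧ 0 ≤ Λ ∧ 0 < b ∧ 0 < aS ∧ N16LettersEnd 2 g ℓ₃ ∧ N16RadiusMatch ℓ₃ B ∧
        KeyedRatesHolderD4 β fun F θ hP g₀ os =>
          ⟨ne1OfRecord l₀ Λ F θ hP g₀ os, ne2OfRecord₁₁ (haveI := neZero_blockFactor F; fullGSizedObjects 3 F.hL b aS ν μ α β' c35 p),
            ne3OfRecord₁₁ F { ne3ConstLayerOfRecord₁₁ F 2 (ℓ₃ F) with
              dom := {V | V ∈ ne3DomOfRecord₁₁ F 2 0 0 ∧ V ∈ sfClass 4 F.L (ne3NperOfRecord₁₁ F 0 0) ((ℓ₃ F).ε / B F) 0} },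
            u3OfRecord₁₃ θ.toStage13Params (objectsOfRecord₁₃ F 2 θ.toStage13Params (ℓ F θ)) (ksel F θ hP g₀ os)⟩ := by
  constructor
  · rintro ⟨β, hβ, hβ', 𝔯, ksel, ℓ, ℓ₃, g, B, hG, hK⟩
    obtain ⟨⟨⟨l₀, Λ, hl₀, hΛ, h1⟩, ⟨b, aS, ν, μ, α, β', c35, p, hb, haS, h2⟩, h3, hL⟩, hE, hM⟩ := (guardedReadingN16_iff_pins_letterRows ksel ℓ ℓ₃ g B).1 hG
    refine ⟨β, hβ, hβ', l₀, Λ, b, aS, ν, μ, α, β', c35, p, ℓ, ℓ₃, g, B, ksel, hl₀, hΛ, hb, haS, hE, hM, ?_⟩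
    have hrr : rrOfRecord 𝔯 ksel = fun F θ hP g₀ os =>
        (⟨ne1OfRecord l₀ Λ F θ hP g₀ os, ne2OfRecord₁₁ (haveI := neZero_blockFactor F; fullGSizedObjects 3 F.hL b aS ν μ α β' c35 p),
          ne3OfRecord₁₁ F { ne3ConstLayerOfRecord₁₁ F 2 (ℓ₃ F) with
            dom := {V | V ∈ ne3DomOfRecord₁₁ F 2 0 0 ∧ V ∈ sfClass 4 F.L (ne3NperOfRecord₁₁ F 0 0) ((ℓ₃ F).ε / B F) 0} },
          u3OfRecord₁₃ θ.toStage13Params (objectsOfRecord₁₃ F 2 θ.toStage13Params (ℓ F θ)) (ksel F θ hP g₀ os)⟩ : RateCarriers 2) := by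
      funext F θ hP g₀ os
      exact rrOfRecord_eq_of_pins h1 h2 h3 hL ksel F θ hP g₀ os
    exact hrr ▸ hK
  · rintro ⟨β, hβ, hβ', l₀, Λ, b, aS, ν, μ, α, β', c35, p, ℓ, ℓ₃, g, B, ksel, hl₀, hΛ, hb, haS, hE, hM, hK⟩
    let lit : (F : T4Family) → (θ : Stage13HParams F 2) → θ.Provisos₁₃CoPH F 2 → (ℕ → ℝ) → List (ULoop F) → RateObjects₁₁ 2 :=
      fun F θ _ _ _ =>
        ⟨objectsOfRecord₁₃ F 2 θ.toStage13Params (ℓ F θ),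
          fun _ => { ne3ConstLayerOfRecord₁₁ F 2 (ℓ₃ F) with
            dom := {V | V ∈ ne3DomOfRecord₁₁ F 2 0 0 ∧ V ∈ sfClass 4 F.L (ne3NperOfRecord₁₁ F 0 0) ((ℓ₃ F).ε / B F) 0} },
          fun _ => haveI := neZero_blockFactor F; fullGSizedObjects 3 F.hL b aS ν μ α β' c35 p⟩
    let 𝔯 : RateReading₁₃CoPH 2 := ⟨lit, ne1OfRecord l₀ Λ⟩
    have hpins : Ne1PinnedOfRecord 𝔯 ∧ N15PinnedSized 𝔯 ∧ U3PinnedKernels 𝔯 ℓ ∧ N16PinnedLoose 𝔯 ℓ₃ B :=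
      ⟨⟨l₀, Λ, hl₀, hΛ, fun _ _ _ _ _ => rfl⟩, ⟨b, aS, ν, μ, α, β', c35, p, hb, haS, fun _ _ _ _ _ _ => rfl⟩, fun _ _ _ _ _ => rfl, fun _ _ _ _ _ _ => rfl⟩
    exact ⟨β, hβ, hβ', 𝔯, ksel, ℓ, ℓ₃, g, B, (guardedReadingN16_iff_pins_letterRows ksel ℓ ℓ₃ g B).2 ⟨hpins, hE, hM⟩, hK⟩

end LetterForm

/-! ## §4 STUB 1's TEXT from the rows (gen-2's bill + the minted reading), and from node N16's producer output -/

section Rows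

variable (β : ℝ) (hβ : 2 / 3 < β) (hβ' : β < 1) (ℓ : LetterReading) (ℓ₃ : T4Family → Node00.NE3Letters₁₁) (g B : T4Family → ℝ)
  (s : (F : T4Family) → Stage13HParams F 2 → ℕ)
  -- node N16's two letter rows (v5's `GuardedReadingN16` conjuncts three and four)
  (hE : N16LettersEnd 2 g ℓ₃) (hM : N16RadiusMatch ℓ₃ B)
  -- the U3 letter block's rows
  (hs : ∀ (F : T4Family) (θ : Stage13HParams F 2), θ.Provisos₁₃CoPH F 2 → (θ.ZhUnity F 2 ∧ θ.SlotsNondegenerate₁₃ F 2) → θ.Admissible F 2 → (ℓ F θ).Signs)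
  (hκ : ∀ (F : T4Family) (θ : Stage13HParams F 2), θ.Provisos₁₃CoPH F 2 → (θ.ZhUnity F 2 ∧ θ.SlotsNondegenerate₁₃ F 2) → θ.Admissible F 2 → 0 < (ℓ F θ).κ)
  (hcr : ∀ (F : T4Family) (θ : Stage13HParams F 2), θ.Provisos₁₃CoPH F 2 → (θ.ZhUnity F 2 ∧ θ.SlotsNondegenerate₁₃ F 2) → θ.Admissible F 2 → betaPrime510 4 1 (ℓ F θ).κ ≤ (ℓ F θ).cr)
  (hρ : ∀ (F : T4Family) (θ : Stage13HParams F 2), θ.Provisos₁₃CoPH F 2 → (θ.ZhUnity F 2 ∧ θ.SlotsNondegenerate₁₃ F 2) → θ.Admissible F 2 → 0 ≤ (ℓ F θ).ρ ∧ (ℓ F θ).ρ < 1)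
  -- def-W1's four finite-volume kernel letters of record
  (hL : ∀ (F : T4Family) (θ : Stage13HParams F 2), θ.Provisos₁₃CoPH F 2 → (θ.ZhUnity F 2 ∧ θ.SlotsNondegenerate₁₃ F 2) → θ.Admissible F 2 → PolLimitsExistOfRecord₁₃ F 2 θ.toStage13Params)
  (h9 : ∀ (F : T4Family) (θ : Stage13HParams F 2), θ.Provisos₁₃CoPH F 2 → (θ.ZhUnity F 2 ∧ θ.SlotsNondegenerate₁₃ F 2) → θ.Admissible F 2 →
    WindowedNE9OfRecord₁₃ F 2 θ.toStage13Params (ℓ F θ).κ (ℓ F θ).moduli)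
  (hW : ∀ (F : T4Family) (θ : Stage13HParams F 2), θ.Provisos₁₃CoPH F 2 → (θ.ZhUnity F 2 ∧ θ.SlotsNondegenerate₁₃ F 2) → θ.Admissible F 2 →
    WindowedDecayOfRecord₁₃ F 2 θ.toStage13Params 0 1 (ℓ F θ).κ)
  (hS : ∀ (F : T4Family) (θ : Stage13HParams F 2), θ.Provisos₁₃CoPH F 2 → (θ.ZhUnity F 2 ∧ θ.SlotsNondegenerate₁₃ F 2) → θ.Admissible F 2 →
    WindowedStepRateOfRecord₁₃ F 2 θ.toStage13Params (s F θ) (ℓ F θ).κ (ℓ F θ).θ₅ ((ℓ F θ).C₅ * (ℓ F θ).θ₅))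
include hβ hβ' hE hM hs hκ hcr hρ hL h9 hW hS

/-- ★★★ **STUB 1's TEXT FROM THE ROWS.**  K3⁷ v5's `stub_rates13H` text VERBATIM (over the mirrored names) from: an exponent `β ∈ ]2/3, 1[`; node N16's two letter rows at
`ℓ₃, g, B`; ONE `N16HolderAt … β` sentence per guarded family at dag-n16-w1's loose-data object (`h16`, THE END's content — module 43 §4 ∕ dag-n16-e's `…LooseMatch` produce it);
the U3 letter rows; def-W1's four finite-volume kernel letters of record.  Proof: the minted all-pins reading (§1, any `l₀ Λ b a_S …` — here `1, 0, 1, 1`), the guard from the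
pin (§2), any selector (here `0`), and gen-2's bill `keyedRatesHolderD4_rrOfRecord_of_pins_of_letters`.  The `∃ 𝔯`, the `KeyedLive` guard and the window of the stub cost
NOTHING; every estimate row stays a displayed HYPOTHESIS (inhabited for no family today).  NOT a proof of the stub. [bookkeeping] -/
theorem stub1Text_of_rows
    (h16 : ∀ (F : T4Family), (∃ θ : Stage13HParams F 2, θ.Provisos₁₃CoPH F 2 ∧ (θ.ZhUnity F 2 ∧ θ.SlotsNondegenerate₁₃ F 2) ∧ θ.Admissible F 2) →
      N16HolderAt (ne3OfRecord₁₁ F { ne3ConstLayerOfRecord₁₁ F 2 (ℓ₃ F) with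
        dom := {V | V ∈ ne3DomOfRecord₁₁ F 2 0 0 ∧ V ∈ sfClass 4 F.L (ne3NperOfRecord₁₁ F 0 0) ((ℓ₃ F).ε / B F) 0} }) β) :
    ∃ β : ℝ, 2 / 3 < β ∧ β < 1 ∧
      ∃ (𝔯 : RateReading₁₃CoPH 2) (ksel : RunSel) (ℓ : LetterReading) (ℓ₃ : T4Family → Node00.NE3Letters₁₁) (g B : T4Family → ℝ),
        GuardedReadingN16 𝔯 ksel ℓ ℓ₃ g B ∧ KeyedRatesHolderD4 β (rrOfRecord 𝔯 ksel) := by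
  obtain ⟨𝔯, h1, h2, h3, hpL⟩ := exists_reading_v5pins 1 0 1 1 0 0 0 0 0 0 ℓ ℓ₃ B one_pos le_rfl one_pos one_pos
  have hG : GuardedReadingN16 𝔯 (fun _ _ _ _ _ => 0) ℓ ℓ₃ g B := (guardedReadingN16_iff_pins_letterRows _ ℓ ℓ₃ g B).2 ⟨⟨h1, h2, h3, hpL⟩, hE, hM⟩
  exact ⟨β, hβ, hβ', 𝔯, fun _ _ _ _ _ => 0, ℓ, ℓ₃, g, B, hG,
    keyedRatesHolderD4_rrOfRecord_of_pins_of_letters 𝔯 (fun _ _ _ _ _ => 0) ℓ ℓ₃ g B β s hG h16 hs hκ hcr hρ hL h9 hW hS⟩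

omit hE hM in
/-- ★★ **STUB 1's TEXT FROM NODE N16's PRODUCER OUTPUT AND THE ROWS.**  The two N16 letter rows AND `h16` are replaced by the OUTPUT SHAPE of dag-n16-e's producers —
`…N16PinnedLooseMatch.exists_letters_n16HolderAtReading_loose_of_h5_thm1At_match` (from `g F > 0`, node N05's `h5`, leaf-06's [B11] Theorem-1 reading `hGm hG C hM hT`) and
`…N16PinnedLooseMatchOfLettersB9Src.…_thm1At_match` conclude `∃ ℓ₃ B, N16LettersEnd 2 g ℓ₃ ∧ (∀ F, 0 < B F ∧ (ℓ₃ F).ε / B F ≤ (ℓ₃ F).b) ∧ (∀ F, (C F).B₃ ≤ B F) ∧ ∀ 𝔯, N16PinnedLoose 𝔯 ℓ₃ B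
→ N16HolderAtReading 𝔯 β` (drop the third conjunct to get `hN16`).  So STUB 1 ⟸ those producers' displayed in-edges + the U3 rows + the four kernel letters, by ONE `obtain`.
`h16` is read off the producer at the minted reading through module 43's `n16HolderAtReading_iff_of_pinnedLoose`.  NOT a proof of the stub. [bookkeeping] -/
theorem stub1Text_of_n16Producer_of_rows
    (hN16 : ∃ (ℓ₃ : T4Family → NE3Letters₁₁) (B : T4Family → ℝ), N16LettersEnd 2 g ℓ₃ ∧ (∀ F : T4Family, 0 < B F ∧ (ℓ₃ F).ε / B F ≤ (ℓ₃ F).b) ∧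
      ∀ 𝔯 : RateReading₁₃CoPH 2, N16PinnedLoose 𝔯 ℓ₃ B → N16HolderAtReading 𝔯 β) :
    ∃ β : ℝ, 2 / 3 < β ∧ β < 1 ∧
      ∃ (𝔯 : RateReading₁₃CoPH 2) (ksel : RunSel) (ℓ : LetterReading) (ℓ₃ : T4Family → Node00.NE3Letters₁₁) (g B : T4Family → ℝ),
        GuardedReadingN16 𝔯 ksel ℓ ℓ₃ g B ∧ KeyedRatesHolderD4 β (rrOfRecord 𝔯 ksel) := by
  obtain ⟨ℓ₃', B', hE', hM', hH⟩ := hN16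
  obtain ⟨𝔯, h1, h2, h3, hpL⟩ := exists_reading_v5pins 1 0 1 1 0 0 0 0 0 0 ℓ ℓ₃' B' one_pos le_rfl one_pos one_pos
  have hG : GuardedReadingN16 𝔯 (fun _ _ _ _ _ => 0) ℓ ℓ₃' g B' := (guardedReadingN16_iff_pins_letterRows _ ℓ ℓ₃' g B').2 ⟨⟨h1, h2, h3, hpL⟩, hE', hM'⟩
  have h16 := (n16HolderAtReading_iff_of_pinnedLoose β hpL).1 (hH 𝔯 hpL)
  exact ⟨β, hβ, hβ', 𝔯, fun _ _ _ _ _ => 0, ℓ, ℓ₃', g, B', hG,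
    keyedRatesHolderD4_rrOfRecord_of_pins_of_letters 𝔯 (fun _ _ _ _ _ => 0) ℓ ℓ₃' g B' β s hG (fun F ⟨θ, hP, _, _⟩ => h16 F ⟨θ, hP⟩) hs hκ hcr hρ hL h9 hW hS⟩

/-! ## §5 K3⁷ by name from the rows and stub 2's text -/

/-- **K3⁷ BY NAME FROM STUB 1's ROWS AND STUB 2's TEXT** (gen-2's `spineGivenEndpointR13SepCoPH_of_stubTexts` ∘ `stub1Text_of_rows`): the item costs exactly §4's rows and
K3⁷ v5's `stub_expansion13H` text (dag-n20-d ∕ n20-w∗ ∕ n21-∗ ∕ n19-∗ at the spine reading of record).  Every row a HYPOTHESIS; NOT a proof of either stub; K3⁷ OPEN. [bookkeeping] -/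
theorem spineGivenEndpointR13SepCoPH_of_rows_of_stub2Text
    (h16 : ∀ (F : T4Family), (∃ θ : Stage13HParams F 2, θ.Provisos₁₃CoPH F 2 ∧ (θ.ZhUnity F 2 ∧ θ.SlotsNondegenerate₁₃ F 2) ∧ θ.Admissible F 2) →
      N16HolderAt (ne3OfRecord₁₁ F { ne3ConstLayerOfRecord₁₁ F 2 (ℓ₃ F) with
        dom := {V | V ∈ ne3DomOfRecord₁₁ F 2 0 0 ∧ V ∈ sfClass 4 F.L (ne3NperOfRecord₁₁ F 0 0) ((ℓ₃ F).ε / B F) 0} }) β)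
    (h₂ : ∀ β : ℝ, 2 / 3 < β → β < 1 → ∀ (𝔯 : RateReading₁₃CoPH 2) (ksel : RunSel) (ℓ : LetterReading) (ℓ₃ : T4Family → Node00.NE3Letters₁₁) (g B : T4Family → ℝ),
      GuardedReadingN16 𝔯 ksel ℓ ℓ₃ g B → KeyedRatesHolderD4 β (rrOfRecord 𝔯 ksel) →
      ∃ (jc : CutReading) (sh : ShellSplit₁₃CoPH 2 0) (cr : SpineReading), PinnedAtLive jc sh cr ∧
        KeyedRelWeight cr ∧ KeyedShellWeight cr ∧ KeyedExtraction cr ∧ KeyedCoreEdgeHolderD4 β cr (rrOfRecord 𝔯 ksel)) :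
    Summit.QuantumFields.YangMills.Theses.BalabanUVNodes.SpineGivenEndpointR13SepCoPH :=
  spineGivenEndpointR13SepCoPH_of_stubTexts (stub1Text_of_rows β hβ hβ' ℓ ℓ₃ g B s hE hM hs hκ hcr hρ hL h9 hW hS h16) h₂

end Rows

end Summit.QuantumFields.YangMills.Theorems.K3V5Defs

/-! ## §6 STUB 1's TEXT from node N05's `h5`, leaf-06's [B11] Theorem-1 reading, the U3 rows and the four kernel letters — node N16's producer CONSUMED BY NAME -/

namespace Summit.QuantumFields.YangMills.Theorems.K3V5Defs

open scoped BigOperators Matrix Matrix.Norms.L2Operator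
open NormedSpace
open Literature.MathematicalPhysics.QuantumFieldTheory.Balaban1983to89
open Literature.MathematicalPhysics.QuantumFieldTheory.Balaban1983to89.T4Continuum (T4Family ULoop)
open Literature.MathematicalPhysics.QuantumFieldTheory.Balaban1983to89.B12Sec2to5 (betaPrime510)
open Literature.MathematicalPhysics.QuantumFieldTheory.Balaban1983to89.Node00.U3KernelLetters (PolLimitsExistOfRecord₁₃ WindowedNE9OfRecord₁₃ WindowedDecayOfRecord₁₃
  WindowedStepRateOfRecord₁₃)
open B7Prop1Explicit B7Prop2Explicit MatrixLog UnitaryModel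
open T4AveragingDeficitWall hiding Site Plaq Bond
open B7Prop3Flat (c3)
open B8LeafModelZd (ZdIdx)
open B8LeafModelZd3 (zdGF3)
open Node00 (Stage13HParams NE3Objects₁₁ NE3Letters₁₁ ne3ConstLayerOfRecord₁₁ ne3NperOfRecord₁₁ ne3DomOfRecord₁₁ MatA)
open Summit.QuantumFields.BalabanUV.T4Continuum
open MinimalActionRate (sfClass)
open MinimalActionDictionary (torusVP RadiiMono)
open AveragingDeficitLatticeH2Prep (fd)
open B11Thm1 (Thm1At)
open YMDAG.UVSplit (RateReading₁₃CoPH)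
open Summit.QuantumFields.YangMills.BalabanUVNodes.N16PinnedLayer13CoPH (N16PinnedLoose N16LettersEnd N16HolderAtReading)
open Summit.QuantumFields.YangMills.BalabanUVNodes.N16PinnedLooseMatch (exists_letters_n16HolderAtReading_loose_of_h5_thm1At_match)

/-- ★★ **STUB 1's TEXT FROM NODE N05's `h5` AND THE [B11] THEOREM-1 READING, BY NAME.**  K3⁷ v5's `stub_rates13H` text VERBATIM from: `β ∈ ]2/3, 1[`; a coupling letter
`g F > 0`; node N05's `h5` (37ᴴ's binder VERBATIM — [B8] Thm 4 ∕ Prop 3 bodies on the `2L^m`-periodic data); leaf-06's local-gauge shape `G F` (`RadiiMono`, the (9)_{β₀=1}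
interface `hG`), constants `C F : B11Thm1.Consts` with `M(ε₁) ≥ 7∕2` on `(0, a₁]`, and `hT : ∀ k, Thm1At (C F) (torusVP 4 F.L Nper (G F) (k+1))` ([Balaban1985Variational] Thm 1
p.279 for the torus instances — DISPLAYED, asserted for nothing); the U3 letter rows; def-W1's four finite-volume kernel letters.  ONE `obtain` on dag-n16-e's producer
`exists_letters_n16HolderAtReading_loose_of_h5_thm1At_match` (letters `ℓ₃`, radius `B F := max (C F).B₃ ((ℓ₃ F).ε ∕ (ℓ₃ F).b)`), then §4's `stub1Text_of_n16Producer_of_rows`.  So under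
v5's pins STUB 1 costs: node N05's `h5` + Theorem 1 at leaf-06's instances + the U3 rows + the kernel letters — no reading, no selector, no guard, no N16 letter residue.  Every in-edge a
displayed HYPOTHESIS; NOT a proof of the stub; N05 ∕ N07 ∕ N16 ∕ N17 ∕ N18 ∕ N22 ∕ (D4) NOT discharged. [bookkeeping] -/
theorem stub1Text_of_h5_thm1At_of_rows (β : ℝ) (hβ : 2 / 3 < β) (hβ' : β < 1) (ℓ : LetterReading) (s : (F : T4Family) → Stage13HParams F 2 → ℕ)
    {g : T4Family → ℝ} (hg : ∀ F, 0 < g F)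
    (h5 : ∀ F : T4Family, letI : CStarAlgebra (Matrix (Fin 2) (Fin 2) ℂ) := {}
      ∃ (len : Site 4 → ℝ) (c₁ c₁' B₁' cP C₂ B₀β : ℝ) (inp : B8.B9Inputs),
        (∀ v : Site 4, 0 < len v → 1 ≤ len v) ∧ (∀ μ : Fin 4, len (e μ) = 1) ∧ 0 < B₁' ∧ 5 * ((4 : ℕ) : ℝ) * F.L * inp.B₀ ≤ B₁' ∧ 0 < c₁' ∧
        (∀ α₀ α₁ : ℝ, 0 < α₀ → 0 < α₁ → α₀ + α₁ ≤ c₁' →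
          α₀ + α₁ ≤ c₁ ∧ C0 4 * (2 * α₀) ≤ 1 / 3 ∧ 4 * α₀ ≤ c2' 4 F.L ∧ 16 * (B₁' * (α₀ + α₁)) ≤ 1 ∧
          Real.exp (4 * (800 * (((4 : ℕ) : ℝ) + 1) ^ 2 * (((4 : ℕ) : ℝ) + 4)) * α₀) * (1 + 8 * (131072 * (((4 : ℕ) : ℝ) + 1) ^ 2) * (B₁' * (α₀ + α₁))) ≤ 2 ∧
          2 * (B₁' * (α₀ + α₁)) ≤ c3 4 F.L ∧ ((4 : ℕ) : ℝ) * F.L * α₁ ≤ 1 / 8 ∧ α₀ ≤ cP ∧ α₁ ≤ cP ∧ B₁' * (α₀ + α₁) ≤ cP ∧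
          2 * (B₁' * (α₀ + α₁)) ^ 2 + 20 * ((4 : ℕ) : ℝ) * α₀ * (B₁' * (α₀ + α₁)) + 2 * C₂ * (B₁' * (α₀ + α₁)) ^ 2 ≤ α₀ + α₁) ∧
        B8.Thm4Body c₁ B₁' (fun i : {i : ZdIdx 4 F.L // (∀ j, i.Ω j = Set.univ) ∧ (∀ m j, i.Λs m j = {_y | j = m}) ∧ (∀ m j, i.Λb m j = {_c | j = m}) ∧ i.η = ((F.L : ℝ)⁻¹) ^ i.k} => (zdGF3 (Matrix (Fin 2) (Fin 2) ℂ) F.L β len i.1).toGFData) ∧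
        B8.Prop3Body cP 4 (F.L : ℝ) C₂ inp B₀β (fun i : {i : ZdIdx 4 F.L // (∀ j, i.Ω j = Set.univ) ∧ (∀ m j, i.Λs m j = {_y | j = m}) ∧ (∀ m j, i.Λb m j = {_c | j = m}) ∧ i.η = ((F.L : ℝ)⁻¹) ^ i.k} => (zdGF3 (Matrix (Fin 2) (Fin 2) ℂ) F.L β len i.1).toGFData2))
    {G : T4Family → (Site 4 → Fin 4 → (MatA 2)ˣ) → Site 4 → ℕ → ℝ → ℝ → ℝ → Prop} (hGm : ∀ F, RadiiMono 4 (G F))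
    (hG : ∀ (F : T4Family) (U : Site 4 → Fin 4 → (MatA 2)ˣ) (x : Site 4) (K : ℕ) (α₀ α₁ α₂ : ℝ), 2 ≤ K → G F U x K α₀ α₁ α₂ →
      ∃ (u : Site 4 → (MatA 2)ˣ) (a : Site 4 → Fin 4 → MatA 2),
        (∀ z, u z ∈ unitaryUnits (MatA 2)) ∧
        (∀ (y : Site 4) (τ : Fin 4), l1 (y - x) ≤ 2 → ((gaugeAct u U y τ : (MatA 2)ˣ) : MatA 2) = exp (a y τ)) ∧
        (∀ (y : Site 4) (τ : Fin 4), l1 (y - x) ≤ 2 → ‖a y τ‖ ≤ α₀) ∧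
        (∀ (y : Site 4) (τ i : Fin 4), l1 (y - x) ≤ 1 → ‖fd i (fun z => a z τ) y‖ ≤ α₁) ∧
        (∀ (τ i l : Fin 4), ‖fd i (fd l (fun z => a z τ)) x‖ ≤ α₂))
    (C : T4Family → B11Thm1.Consts) (hM : ∀ (F : T4Family) (e : ℝ), 0 < e → e ≤ (C F).a₁ → 7 / 2 ≤ (C F).Mfun e)
    (hT : ∀ (F : T4Family) (k : ℕ), Thm1At (C F) (torusVP 4 F.L (ne3NperOfRecord₁₁ F 0 0) (G F) (k + 1)))
    (hs : ∀ (F : T4Family) (θ : Stage13HParams F 2), θ.Provisos₁₃CoPH F 2 → (θ.ZhUnity F 2 ∧ θ.SlotsNondegenerate₁₃ F 2) → θ.Admissible F 2 → (ℓ F θ).Signs)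
    (hκ : ∀ (F : T4Family) (θ : Stage13HParams F 2), θ.Provisos₁₃CoPH F 2 → (θ.ZhUnity F 2 ∧ θ.SlotsNondegenerate₁₃ F 2) → θ.Admissible F 2 → 0 < (ℓ F θ).κ)
    (hcr : ∀ (F : T4Family) (θ : Stage13HParams F 2), θ.Provisos₁₃CoPH F 2 → (θ.ZhUnity F 2 ∧ θ.SlotsNondegenerate₁₃ F 2) → θ.Admissible F 2 → betaPrime510 4 1 (ℓ F θ).κ ≤ (ℓ F θ).cr)
    (hρ : ∀ (F : T4Family) (θ : Stage13HParams F 2), θ.Provisos₁₃CoPH F 2 → (θ.ZhUnity F 2 ∧ θ.SlotsNondegenerate₁₃ F 2) → θ.Admissible F 2 → 0 ≤ (ℓ F θ).ρ ∧ (ℓ F θ).ρ < 1)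
    (hL : ∀ (F : T4Family) (θ : Stage13HParams F 2), θ.Provisos₁₃CoPH F 2 → (θ.ZhUnity F 2 ∧ θ.SlotsNondegenerate₁₃ F 2) → θ.Admissible F 2 → PolLimitsExistOfRecord₁₃ F 2 θ.toStage13Params)
    (h9 : ∀ (F : T4Family) (θ : Stage13HParams F 2), θ.Provisos₁₃CoPH F 2 → (θ.ZhUnity F 2 ∧ θ.SlotsNondegenerate₁₃ F 2) → θ.Admissible F 2 →
      WindowedNE9OfRecord₁₃ F 2 θ.toStage13Params (ℓ F θ).κ (ℓ F θ).moduli)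
    (hW : ∀ (F : T4Family) (θ : Stage13HParams F 2), θ.Provisos₁₃CoPH F 2 → (θ.ZhUnity F 2 ∧ θ.SlotsNondegenerate₁₃ F 2) → θ.Admissible F 2 →
      WindowedDecayOfRecord₁₃ F 2 θ.toStage13Params 0 1 (ℓ F θ).κ)
    (hS : ∀ (F : T4Family) (θ : Stage13HParams F 2), θ.Provisos₁₃CoPH F 2 → (θ.ZhUnity F 2 ∧ θ.SlotsNondegenerate₁₃ F 2) → θ.Admissible F 2 →
      WindowedStepRateOfRecord₁₃ F 2 θ.toStage13Params (s F θ) (ℓ F θ).κ (ℓ F θ).θ₅ ((ℓ F θ).C₅ * (ℓ F θ).θ₅)) :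
    ∃ β : ℝ, 2 / 3 < β ∧ β < 1 ∧
      ∃ (𝔯 : RateReading₁₃CoPH 2) (ksel : RunSel) (ℓ : LetterReading) (ℓ₃ : T4Family → Node00.NE3Letters₁₁) (g B : T4Family → ℝ),
        GuardedReadingN16 𝔯 ksel ℓ ℓ₃ g B ∧ KeyedRatesHolderD4 β (rrOfRecord 𝔯 ksel) := by
  have hβ0 : 0 ≤ β := by linarith
  obtain ⟨ℓ₃, B, hE, hM', -, hH⟩ := exists_letters_n16HolderAtReading_loose_of_h5_thm1At_match (N := 2) hβ0 hβ'.le hg h5 hGm hG C hM hT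
  exact stub1Text_of_n16Producer_of_rows (β := β) (hβ := hβ) (hβ' := hβ') (ℓ := ℓ) (g := g) (s := s) (hs := hs) (hκ := hκ) (hcr := hcr) (hρ := hρ)
    (hL := hL) (h9 := h9) (hW := hW) (hS := hS) ⟨ℓ₃, B, hE, hM', hH⟩

end Summit.QuantumFields.YangMills.Theorems.K3V5Defs

end
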